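import Summits.QuantumFields.YangMills.Theorems.BalabanUVNodesK0AllTorusOfStepTokensRCube
import Literature.MathematicalPhysics.QuantumFieldTheory.Balaban1983to89.B8Prop6CubeMemberOfPrinted

/-!
# K0⁷ STUB 2 (`stub_prop6MemberB8At13`, skeleton V18) — THE K0 END OF THE PRINTED-ALL ROAD: V18's registered stub-2 BODY from [6] THEOREM 4 ∧ PROPOSITION 3
# AS PRINTED on n05-a's `ℤ⁴ × M₂(ℂ)` carrier over the cube sub-family of (1.131), plus the carrier-free DOORS every supplier road of NODE 00's member ends in

Cell `pub-ymgap`, width seat `pub-ymgap-k0-s2-w1` (g0; director-ym №197 ∕ HUMAN RULING D-0149; plan g77 W-SEAT-START-LIST v3 §k0-s2 item 1 «the PRINTED-ALL road»;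
dag-n21-c g16 `N21C-G16-WSEAT-START-INPUT.md` §A2).  `--kind proof --supports stmt-QuantumFields-20541 --as helper`.
[6] = [Balaban1985RegularSpaces]; [15] = [Balaban1985Variational]; [I] = [Balaban1987RG1]; [III] = [Balaban1988Convergent].

THE STUB (V18 `K0Skeleton13SepCoPHV18.lean` 3bcb71246bb7298d, registered on stmt-QuantumFields-20541):
`stub_prop6MemberB8At13 : ∀ F, Prop6MemberB8At F`, `Prop6MemberB8At F := ∃ B₁ c₁, 0 ≤ B₁ ∧ 0 < c₁ ∧ (letI : CStarAlgebra (MatA 2) := {};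
B8.Prop6Printed 4 (F.L : ℝ) B₁ c₁ (fun i : ZdIdx 4 F.L => zdCub (MatA 2) F.L i))` — [6] Proposition 6 (1.135)–(1.138) p. 99 AT NODE 00's cube member `Node00.zdCub` over n05-a's
whole index `ZdIdx 4 F.L`; VERBATIM the hypothesis `hP6` of dag-n07-e's bridge `Node00.gauge152R_of_prop6` and the binder `h2` of dag-n21-c's composition
`K0AllTorusOfStepTokensRCube.record13SepCoPHBody_of_stubs123A`.  Every theorem below CONCLUDES THAT BODY VERBATIM (so a supplier landing any of the displayed inputs
closes stub 2 by one `exact`).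

WHAT THIS FILE PROVES (theorems only; 0 `def`; nothing of Bałaban asserted).
§1 DOORS (carrier-free; survive any re-typing of the `zdGF3` letters):
   `prop6MemberB8At_of_prop6Printed` — the body from `B8.Prop6Printed 4 L B₁ c₁ (zdCub (MatA 2) F.L ·)` at ANY `0 ≤ B₁`, `0 < c₁` (∃-introduction at the instance of record);
   `prop6MemberB8At_of_prop6PrintedFamily` — the body from dag-n05-e's PLUG SHAPE `∃ B₀ˢ, 1 ≤ B₀ˢ ∧ ∃ c₁, 0 < c₁ ∧ ∀ {ι} (f : ι → ZdIdx 4 F.L), B8.Prop6Printed 4 L (5·4·L·B₀ˢ) c₁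
   (zdCub ∘ f)` (the conclusion shape of `B8Prop6CubeMemberOfThm33BetaExists.prop6Printed_zdCub_of_thm33β₃` ∕ `…_of_sockD4βFamily₃` and of their γ successors) at `f := id`;
   `prop6MemberB8At_of_gaugedBoundB8` — the body from the PER-CUBE sentence over ALL `CubeB8` cubes «`∀ η > 0, ∀ K Ω (c : CubeB8 4 L K Ω) U₀ unitary, ∀ α₀ > 0, U₀ ∈ 𝔄_K({Ω_j}, α₀) →
   7·4·L²·c.M·α₀ ≤ c₁ → GaugedBoundB8 L η U₀ c (7·4·L²·B₁·c.M·α₀)`» (the conclusion shape of `B8Prop6CubeMemberOfPrinted.gaugedBoundB8_cubeMember_of_printed(All)` and the socket a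
   per-cube D2γ-type output plugs into; = `Node00.prop6Printed_zdCub_iff` read at `η := i.η`, `K := i.k`, `Ω := i.Ω`).
§2 ★ `prop6MemberB8At_of_printed` — THE PRINTED-ALL ROAD PROPER: `H4 : B8.Thm4Printed (5·4·L·inp.B₀) ((zdGF3 (MatA 2) F.L β len ·.1).toGFData)` ([6] Thm 4 p. 88 AS PRINTED) and
   `H3 : B8.Prop3Printed 4 L C₂ inp B₀β ((zdGF3 (MatA 2) F.L β len ·.1).toGFData2)` ([6] Prop. 3 p. 87 AS PRINTED) on the CUBE SUB-FAMILY of `ZdIdx 4 F.L` (the members whose domains are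
   a cube family `{□_j}` of (1.131) in `CubeB8`'s regime `L ≤ ρ ≤ M`, `44 < M`, `L ≤ 4M`) ⟹ the stub-2 body with `B₁ := 5·4·L·inp.B₀` — dag-n05-e g6's socket-free
   `prop6Printed_zdCub_of_printed` (print p. 99: «the assumptions of Theorem 4 are satisfied for the pair 1, U₀″ …») read at `𝔸 := M₂(ℂ)`, `d := 4`, `f := id`;
   `prop6MemberB8At_of_printedAll` — the same from the WHOLE-INDEX binders (`prop6Printed_zdCub_of_printedAll`; stronger hypotheses, recorded for the H4-currency knits).
§3 `record13SepCoPHBody_of_stub1_printed_stub3A` — K0⁷'s body on EVERY family from stub 1, the two printed sentences of §2 at every `F`, and stub 3ᴬ (Cʷ″ ∘ §2).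

HONEST SCOPE ∕ A6 (director-ym №189 (3)).  K0-side SOCKETS BY NAME.  `H4` ∕ `H3` are DISPLAYED HYPOTHESES of printed shape, NOT inhabited in this file and not inhabited anywhere in
the tree at cube members tonight: every β-edition supplier of Theorem 4 at nested members is VACUOUS AS TYPED (dag-n05-c certificates `B8Ineq159FlatShellModeVacuity` p572834,
`B8SockB9P3ShellModeVacuityUniv` p576185; scope notes on `B8Thm4ConcreteBdryBeta` & co.), the repaired class is `cubeLamBP` (p573921) and the edition-γ suppliers are the N05∕N06
lanes' live D-chain (dag-n06-b `B9SupplySockB9P3ZdGamma(Univ)` p579891∕p580942, dag-n05-e `B8Eq142KLevelLocalGamma` p580875, `B8Thm4KLevelGamma`, `B8Thm4ExistsConcreteGamma` …).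
LOCATED READINGS THAT APPLY VERBATIM: (i) dag-n05-e LOCATED-AVG135 (bus 2026-08-27 22:46Z): `zdGF3.avgClose166` guards (1.35)∕(1.66) by «box ⊂ Ω_j», so `B8.Thm4Printed (zdGF3 …)`
asserts Theorem 4's conclusion from LESS than print's (1.35) (p. 77 bond convention) — §2's `H4` carries that reading until n05-a's `zdGF3` letter is re-typed (§1 is `zdGF3`-free;
§2∕§3 re-key by token swap); (ii) dag-n05-e LOCATED-CARRIER (bus 19:21Z): `Node00.CubeB8` admits collars `ρ = L` and ragged sides `M`, so the stub text (= Prop. 6 at EVERY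
`CubeB8` cube) is wider than print's p. 98 cubes, and it is CONSUMED that way (dag-n07-e `gauge152R_of_prop6` reads `propCube`, `ρ = L`, `M′ = M + 44 + L`).  No joint-satisfiability
claim of `H4 ∧ H3` is made.  Kernel floor met by §2's witness: `B₁ = 20·L·inp.B₀ > 0` (FILE D `K0Gauge152RFluxFloor.pos_of_prop6Member` demands `0 < B₁`).  Stub 2 ∕ N05 ∕ K0⁷
NOT discharged; counts unmoved (typed 28∕28 · discharged 5∕27); one finite 𝕋⁴ programme at fixed `ε = L^{−K}`, Bałaban AS PRINTED — NOT continuum ∕ ℝ⁴ ∕ OS ∕ mass gap ∕ Clay: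
the Yang–Mills mass gap is NOT proved by any of this; route R4 closes the CONDITIONAL finite-𝕋⁴ rung `BalabanLadder.UV` only.  No `sorry`, `def`, `instance`, `notation`;
standard axioms; default heartbeats.
-/

noncomputable section

open scoped Matrix.Norms.L2Operator

namespace Summit.QuantumFields.YangMills.Theorems.K0Stub2OfPrintedZdCub

open Literature.MathematicalPhysics.QuantumFieldTheory.Balaban1983to89
open Literature.MathematicalPhysics.QuantumFieldTheory.Balaban1983to89.Node00
open Literature.MathematicalPhysics.QuantumFieldTheory.Balaban1983to89.T4Continuum
open Literature.MathematicalPhysics.QuantumFieldTheory.Balaban1983to89.FlowStep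
open Literature.MathematicalPhysics.QuantumFieldTheory.Balaban1983to89.B8LeafModelZd (ZdIdx)
open Literature.MathematicalPhysics.QuantumFieldTheory.Balaban1983to89.B8LeafModelZd3 (zdGF3)
open Literature.MathematicalPhysics.QuantumFieldTheory.Balaban1983to89.B8Ineq132 (InAk)
open Literature.MathematicalPhysics.QuantumFieldTheory.Balaban1983to89.B7Prop2Explicit (unitaryUnits)
open Literature.MathematicalPhysics.QuantumFieldTheory.Balaban1983to89.B8Eq131CubesAdmissible (cubeFam)
open Literature.MathematicalPhysics.QuantumFieldTheory.Balaban1983to89.B8CubeMemberZd (cubeLamS cubeLamB)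
open Literature.MathematicalPhysics.QuantumFieldTheory.Balaban1983to89.B8Prop6CubeMemberOfPrinted (prop6Printed_zdCub_of_printed prop6Printed_zdCub_of_printedAll)
open Summit.QuantumFields.YangMills.Theorems.K0AllTorusOfStepTokensRCube (record13SepCoPHBody_of_stubs123A)

variable (F : T4Family)

/-! ## §1. The carrier-free doors into V18 stub 2's registered body -/

section Doors

/-- **DOOR 1 — the stub-2 body from [6] Proposition 6 at NODE 00's member at ANY admissible constants** (`0 ≤ B₁`, `0 < c₁`): ∃-introduction at the
`CStarAlgebra (MatA 2)` instance of record.  Conclusion = V18 `Prop6MemberB8At F` ∕ Cʷ″'s `h2 F` VERBATIM. [cite: Balaban1985RegularSpaces, Prop. 6 (1.135)–(1.138) p.99] -/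
theorem prop6MemberB8At_of_prop6Printed {B₁ c₁ : ℝ} (hB₁ : 0 ≤ B₁) (hc₁ : 0 < c₁)
    (hP6 : letI : CStarAlgebra (MatA 2) := {}; B8.Prop6Printed 4 (F.L : ℝ) B₁ c₁ (fun i : ZdIdx 4 F.L => zdCub (MatA 2) F.L i)) :
    ∃ B₁ c₁ : ℝ, 0 ≤ B₁ ∧ 0 < c₁ ∧
      (letI : CStarAlgebra (MatA 2) := {}; B8.Prop6Printed 4 (F.L : ℝ) B₁ c₁ (fun i : ZdIdx 4 F.L => zdCub (MatA 2) F.L i)) :=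
  ⟨B₁, c₁, hB₁, hc₁, hP6⟩

/-- **DOOR 2 — the stub-2 body from dag-n05-e's PLUG SHAPE** `∃ B₀ˢ ≥ 1, ∃ c₁ > 0, ∀ f, B8.Prop6Printed 4 L (5·4·L·B₀ˢ) c₁ (zdCub ∘ f)` (the conclusion shape of the N06→N05
junction knits `prop6Printed_zdCub_of_thm33β₃` ∕ `prop6Printed_zdCub_of_sockD4βFamily₃` once their sockets are fed, and of their edition-γ successors), read at `f := id`;
`B₁ := 5·4·L·B₀ˢ ≥ 0`. [cite: Balaban1985RegularSpaces, Prop. 6 p.99, Prop. 3 p.87 («B₁ = 5dLB₀»)] -/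
theorem prop6MemberB8At_of_prop6PrintedFamily
    (h : letI : CStarAlgebra (MatA 2) := {};
      ∃ B₀S : ℝ, 1 ≤ B₀S ∧ ∃ c₁ : ℝ, 0 < c₁ ∧ ∀ {ι : Type} (f : ι → ZdIdx 4 F.L),
        B8.Prop6Printed 4 (F.L : ℝ) (5 * ((4 : ℕ) : ℝ) * F.L * B₀S) c₁ (fun j => zdCub (MatA 2) F.L (f j))) :
    ∃ B₁ c₁ : ℝ, 0 ≤ B₁ ∧ 0 < c₁ ∧
      (letI : CStarAlgebra (MatA 2) := {}; B8.Prop6Printed 4 (F.L : ℝ) B₁ c₁ (fun i : ZdIdx 4 F.L => zdCub (MatA 2) F.L i)) := by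
  letI : CStarAlgebra (MatA 2) := {}
  obtain ⟨B₀S, hB₀S, c₁, hc₁, hP⟩ := h
  refine ⟨5 * ((4 : ℕ) : ℝ) * F.L * B₀S, c₁, ?_, hc₁, hP (fun i => i)⟩
  have hL : (0 : ℝ) ≤ (F.L : ℝ) := Nat.cast_nonneg _
  have hB : (0 : ℝ) ≤ B₀S := le_trans zero_le_one hB₀S
  positivity

/-- **DOOR 3 — the stub-2 body from the PER-CUBE SENTENCE over ALL `CubeB8` cubes**: «there are `B₁ ≥ 0`, `c₁ > 0` such that for every spacing `η > 0`, every ambient family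
`{Ω_j}_{j ≤ K}`, every cube `c : CubeB8 4 L K Ω`, every unitary `U₀ ∈ 𝔄_K({Ω_j}, α₀)` with `7·4·L²·c.M·α₀ ≤ c₁`: `GaugedBoundB8 L η U₀ c (7·4·L²·B₁·c.M·α₀)`» — the conclusion shape of
dag-n05-e's `gaugedBoundB8_cubeMember_of_printed(All)` (and of any per-cube D2γ-type output); `Node00.prop6Printed_zdCub_iff` read at `(η, K, Ω) := (i.η, i.k, i.Ω)`, `i.hη`.
[cite: Balaban1985RegularSpaces, Prop. 6 (1.135)–(1.138) p.99, p.98] -/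
theorem prop6MemberB8At_of_gaugedBoundB8
    (h : letI : CStarAlgebra (MatA 2) := {};
      ∃ B₁ c₁ : ℝ, 0 ≤ B₁ ∧ 0 < c₁ ∧ ∀ (η : ℝ), 0 < η → ∀ {K : ℕ} {Ω : ℕ → Set (B7Prop1Explicit.Site 4)} (c : CubeB8 4 F.L K Ω),
        ∀ (U₀ : B7Prop1Explicit.Site 4 → Fin 4 → (MatA 2)ˣ), (∀ x κ, U₀ x κ ∈ unitaryUnits (MatA 2)) → ∀ (α₀ : ℝ), 0 < α₀ → InAk F.L K η α₀ Ω U₀ →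
        7 * (4 : ℕ) * (F.L : ℝ) ^ 2 * c.M * α₀ ≤ c₁ →
        GaugedBoundB8 F.L η U₀ c (7 * (4 : ℕ) * (F.L : ℝ) ^ 2 * B₁ * c.M * α₀)) :
    ∃ B₁ c₁ : ℝ, 0 ≤ B₁ ∧ 0 < c₁ ∧
      (letI : CStarAlgebra (MatA 2) := {}; B8.Prop6Printed 4 (F.L : ℝ) B₁ c₁ (fun i : ZdIdx 4 F.L => zdCub (MatA 2) F.L i)) := by
  letI : CStarAlgebra (MatA 2) := {}
  obtain ⟨B₁, c₁, hB₁, hc₁, G⟩ := h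
  refine ⟨B₁, c₁, hB₁, hc₁, ?_⟩
  rw [prop6Printed_zdCub_iff]
  intro j α₀ hα U₀ hInA c hs
  exact G j.η j.hη c U₀.1 U₀.2 α₀ hα hInA hs

end Doors

/-! ## §2. ★ The PRINTED-ALL road: the body from [6] Theorem 4 and Proposition 3 AS PRINTED on the `ℤ⁴ × M₂(ℂ)` carrier -/

section Printed

/-- **★ THE PRINTED-ALL ROAD AT `F`, CUBE SUB-FAMILY** — V18 stub 2's body from [6] THEOREM 4 (p. 88) AND PROPOSITION 3 (p. 87) AS PRINTED on n05-a's carrier `zdGF3 (M₂(ℂ)) F.L β len`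
over the CUBE SUB-FAMILY of `ZdIdx 4 F.L` (members whose domains are a cube family `{□_j}_{j=0}^{k}` of (1.131) with print's truncations, in `CubeB8`'s regime `L ≤ ρ ≤ M`,
`11·4 < M`, `L ≤ 4M`), for ANY [4]-inputs `inp : B8.B9Inputs`, Hölder exponent `β`, length `len`, `B₀β` and `C₂ ≥ 0`: witness `B₁ := 5·4·L·inp.B₀` (print's «B₁ = 5dLB₀», Prop. 3) and
the threshold `c₁ > 0` of dag-n05-e g6's socket-free `prop6Printed_zdCub_of_printed` (print p. 99: «If 7dL²Mα₀ ≤ c₁, then the assumptions of Theorem 4 are satisfied for the pair of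
configurations 1, U₀″ …»), read at `𝔸 := M₂(ℂ)`, `d := 4`, `f := id`.  `H4`, `H3` DISPLAYED, not inhabited (edition γ pending; LOCATED-AVG135 reading of `zdGF3.avgClose166` applies).
[cite: Balaban1985RegularSpaces, Prop. 6 (1.135)–(1.138) p.99, p.99 (sentence after (1.133)), Thm 4 (1.67) p.88, Prop. 3 (1.43)–(1.45) p.87, (1.131) p.99] -/
theorem prop6MemberB8At_of_printed (inp : B8.B9Inputs) {B₀β C₂ : ℝ} (hC₂ : 0 ≤ C₂) (β : ℝ) (len : B7Prop1Explicit.Site 4 → ℝ)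
    (H4 : letI : CStarAlgebra (MatA 2) := {};
      B8.Thm4Printed (5 * ((4 : ℕ) : ℝ) * F.L * inp.B₀)
        (fun i : {i : ZdIdx 4 F.L // ∃ (a : B7Prop1Explicit.Site 4) (M ρ : ℕ), F.L ≤ ρ ∧ ρ ≤ M ∧ 11 * 4 < M ∧ F.L ≤ 4 * M ∧
          i.Ω = cubeFam false F.L a M ρ i.k ∧ i.Λs = cubeLamS F.L a M ρ i.k ∧ i.Λb = cubeLamB F.L a M ρ i.k} =>
          (zdGF3 (MatA 2) F.L β len i.1).toGFData))
    (H3 : letI : CStarAlgebra (MatA 2) := {};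
      B8.Prop3Printed 4 (F.L : ℝ) C₂ inp B₀β
        (fun i : {i : ZdIdx 4 F.L // ∃ (a : B7Prop1Explicit.Site 4) (M ρ : ℕ), F.L ≤ ρ ∧ ρ ≤ M ∧ 11 * 4 < M ∧ F.L ≤ 4 * M ∧
          i.Ω = cubeFam false F.L a M ρ i.k ∧ i.Λs = cubeLamS F.L a M ρ i.k ∧ i.Λb = cubeLamB F.L a M ρ i.k} =>
          (zdGF3 (MatA 2) F.L β len i.1).toGFData2)) :
    ∃ B₁ c₁ : ℝ, 0 ≤ B₁ ∧ 0 < c₁ ∧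
      (letI : CStarAlgebra (MatA 2) := {}; B8.Prop6Printed 4 (F.L : ℝ) B₁ c₁ (fun i : ZdIdx 4 F.L => zdCub (MatA 2) F.L i)) := by
  letI : CStarAlgebra (MatA 2) := {}
  obtain ⟨c₁, hc₁, G⟩ := prop6Printed_zdCub_of_printed (𝔸 := MatA 2) (d := 4) (by norm_num) (show 2 ≤ F.L by have := F.hL11; omega) inp hC₂ β len H4 H3
  refine ⟨5 * ((4 : ℕ) : ℝ) * F.L * inp.B₀, c₁, ?_, hc₁, G (fun i => i)⟩
  have hL : (0 : ℝ) ≤ (F.L : ℝ) := Nat.cast_nonneg _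
  have hB : (0 : ℝ) ≤ inp.B₀ := inp.B₀_pos.le
  positivity

/-- **THE PRINTED-ALL ROAD AT `F`, WHOLE INDEX** — the same from [6] Theorem 4 and Proposition 3 AS PRINTED hypothesised on the WHOLE index `ZdIdx 4 F.L` (the `H4` ∕ `p3` binders of
n05-a's H4-currency knit `B8LeafKnitZd3OfThm4.b8LeafRS_zd3_univ_of_thm4` verbatim; STRONGER hypotheses than the cube sub-family form — restriction is pure logic,
`prop6Printed_zdCub_of_printedAll`).  Displayed, not inhabited. [cite: Balaban1985RegularSpaces, Prop. 6 p.99, Thm 4 p.88, Prop. 3 p.87] -/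
theorem prop6MemberB8At_of_printedAll (inp : B8.B9Inputs) {B₀β C₂ : ℝ} (hC₂ : 0 ≤ C₂) (β : ℝ) (len : B7Prop1Explicit.Site 4 → ℝ)
    (H4 : letI : CStarAlgebra (MatA 2) := {};
      B8.Thm4Printed (5 * ((4 : ℕ) : ℝ) * F.L * inp.B₀) (fun i : ZdIdx 4 F.L => (zdGF3 (MatA 2) F.L β len i).toGFData))
    (H3 : letI : CStarAlgebra (MatA 2) := {};
      B8.Prop3Printed 4 (F.L : ℝ) C₂ inp B₀β (fun i : ZdIdx 4 F.L => (zdGF3 (MatA 2) F.L β len i).toGFData2)) :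
    ∃ B₁ c₁ : ℝ, 0 ≤ B₁ ∧ 0 < c₁ ∧
      (letI : CStarAlgebra (MatA 2) := {}; B8.Prop6Printed 4 (F.L : ℝ) B₁ c₁ (fun i : ZdIdx 4 F.L => zdCub (MatA 2) F.L i)) := by
  letI : CStarAlgebra (MatA 2) := {}
  obtain ⟨c₁, hc₁, G⟩ := prop6Printed_zdCub_of_printedAll (𝔸 := MatA 2) (d := 4) (by norm_num) (show 2 ≤ F.L by have := F.hL11; omega) inp hC₂ β len H4 H3
  refine ⟨5 * ((4 : ℕ) : ℝ) * F.L * inp.B₀, c₁, ?_, hc₁, G (fun i => i)⟩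
  have hL : (0 : ℝ) ≤ (F.L : ℝ) := Nat.cast_nonneg _
  have hB : (0 : ℝ) ≤ inp.B₀ := inp.B₀_pos.le
  positivity

end Printed

/-! ## §3. K0⁷'s body on every family from stub 1, the two printed sentences at every `F`, and stub 3ᴬ -/

section Composition

/-- **K0⁷'s BODY ON EVERY FAMILY FROM STUB 1, [6] THM 4 ∧ PROP 3 AS PRINTED AT EVERY `F` (cube sub-family), AND STUB 3ᴬ** — dag-n21-c's Cʷ″ `record13SepCoPHBody_of_stubs123A` with its
`h2` (= V18 stub 2) supplied by §2 `prop6MemberB8At_of_printed`: the printed inputs `(inp, B₀β, C₂ ≥ 0, β, len, H4, H3)` are taken PER FAMILY `F`.  Hypothesis form; CONDITIONAL;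
K0⁷ NOT closed; nothing of Bałaban asserted. [cite: Balaban1985Variational, Thm 1 (8)–(9) p.279, Prop. 8 p.304; Balaban1985RegularSpaces, Prop. 6 p.99, Thm 4 p.88, Prop. 3 p.87; Balaban1988Convergent, Thm 1 p.262, (2.6)–(2.8) pp.255–256; Balaban1987RG1, Thm 1 p.259, §1 p.264] -/
theorem record13SepCoPHBody_of_stub1_printed_stub3A
    (h1 : ∀ F : T4Family, ∃ B₃ a₀ a₁ : ℝ, 2 * (F.L : ℝ) ^ 2 ≤ B₃ ∧ 0 < a₀ ∧ 0 < a₁ ∧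
      Prop8RegSepTopStep F 2 (fun ν K Ω => suppDomOfRecord F ν K Ω) B₃ a₀ a₁)
    (h2P : ∀ F : T4Family, ∃ (inp : B8.B9Inputs) (B₀β C₂ β : ℝ) (len : B7Prop1Explicit.Site 4 → ℝ), 0 ≤ C₂ ∧
      (letI : CStarAlgebra (MatA 2) := {};
        B8.Thm4Printed (5 * ((4 : ℕ) : ℝ) * F.L * inp.B₀)
          (fun i : {i : ZdIdx 4 F.L // ∃ (a : B7Prop1Explicit.Site 4) (M ρ : ℕ), F.L ≤ ρ ∧ ρ ≤ M ∧ 11 * 4 < M ∧ F.L ≤ 4 * M ∧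
            i.Ω = cubeFam false F.L a M ρ i.k ∧ i.Λs = cubeLamS F.L a M ρ i.k ∧ i.Λb = cubeLamB F.L a M ρ i.k} =>
            (zdGF3 (MatA 2) F.L β len i.1).toGFData)) ∧
      (letI : CStarAlgebra (MatA 2) := {};
        B8.Prop3Printed 4 (F.L : ℝ) C₂ inp B₀β
          (fun i : {i : ZdIdx 4 F.L // ∃ (a : B7Prop1Explicit.Site 4) (M ρ : ℕ), F.L ≤ ρ ∧ ρ ≤ M ∧ 11 * 4 < M ∧ F.L ≤ 4 * M ∧
            i.Ω = cubeFam false F.L a M ρ i.k ∧ i.Λs = cubeLamS F.L a M ρ i.k ∧ i.Λb = cubeLamB F.L a M ρ i.k} =>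
            (zdGF3 (MatA 2) F.L β len i.1).toGFData2)))
    (h3A : ∀ (F : T4Family) (B₃ B₃' a₀ a₁ : ℝ), 2 * (F.L : ℝ) ^ 2 ≤ B₃ → 0 < B₃' → 0 < a₀ → 0 < a₁ →
      VariationalThm1RegSepCoP7M F 2 B₃ a₀ a₁ →
      Gauge9RegSepTopStepR F 2 (fun ν K Ω => suppDomOfRecord F ν K Ω) (F.L ^ 3) ((11 * 4 + 3 * F.L) * F.L) B₃ B₃' a₀ a₁ →
      ∃ γ₀ ε₀ ε₂₉ β' : ℝ, 0 < γ₀ ∧ 0 < ε₀ ∧ 0 < ε₂₉ ∧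
        BetaLowerH (-β') γ₀ (betaOfRecord₁₃ F 2 (theta13OfThm1CCM F 2 3 ε₀ ε₂₉ B₃ B₃' a₀ a₁)) ∧
        BetaUpperH β' γ₀ (betaOfRecord₁₃ F 2 (theta13OfThm1CCM F 2 3 ε₀ ε₂₉ B₃ B₃' a₀ a₁))) :
    ∀ F : T4Family, ∃ θ : Stage13HParams F 2, θ.Provisos₁₃SepCoPH F 2 ∧ (θ.ZhUnity F 2 ∧ θ.SlotsNondegenerate₁₃ F 2) ∧ θ.Admissible F 2 :=
  record13SepCoPHBody_of_stubs123A h1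
    (fun F => by
      obtain ⟨inp, B₀β, C₂, β, len, hC₂, H4, H3⟩ := h2P F
      exact prop6MemberB8At_of_printed F inp hC₂ β len H4 H3)
    h3A

end Composition

end Summit.QuantumFields.YangMills.Theorems.K0Stub2OfPrintedZdCub

end
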